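import Summits.BirchSwinnertonDyer.BirchSwinnertonDyer.Theorems.KimAtThreeStubPinnedLift
import Summits.BirchSwinnertonDyer.BirchSwinnertonDyer.Theorems.KimAtThreeStubTorsionLevels
import Summits.BirchSwinnertonDyer.BirchSwinnertonDyer.Theorems.KimAtThreeDeepLowerS24DeepOrderOfPinned
import Summits.BirchSwinnertonDyer.BirchSwinnertonDyer.Theorems.KimAtThreeShallowEqDeepGoodCoreVertexHord
import Summits.BirchSwinnertonDyer.Rank1Residual.GaloisImage.SakamotoN11InstanceWeil
import Summits.BirchSwinnertonDyer.Rank1Residual.GaloisImage.SakamotoN11InstanceFitting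
import Summits.BirchSwinnertonDyer.Rank1Residual.GaloisImage.SakamotoN11InstanceLevelOneLocal
import Summits.BirchSwinnertonDyer.Rank1Residual.GaloisImage.KolyvaginLevelOneUnitCase
import Summits.BirchSwinnertonDyer.Rank1Residual.GaloisImage.SelmerGroupFinite
import Literature.NumberTheory.GaloisCohomology.Sakamoto2024KolyvaginRankOne
import Literature.NumberTheory.GaloisCohomology.Sakamoto2024KolyvaginFittingIdeal
import HarnessLib

/-!
# Route `KimAtThreeKolyvagin` (rung W2), crux `StubAtEmptyLevelThree` (item 19561): the stub at `∅` for
# the PINNED datum from Sakamoto 2024 Thm. 4.4 (1)(2) AS PRINTED and three Poitou–Tate pair counts at `∅`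

Cell `bsd-addord`, seat `bsd-addord-w2-c5` (gen 3). TOOL FILE: theorems only, no definition, no named fact, no
`sorry`; closes nothing; books nothing. HONEST FRAMING: BSD is not proved by any of this; item 19561 stays
OPEN (aside); every theorem is CONDITIONAL on the two PUBLISHED pinned Literature facts
`Sakamoto2024.kolyvaginSystems_freeRankOne_zmod_three_pow` / `…idealOfBasis_eq_fittingIdeal_zmod_three_pow`
([S24] Thm. 4.4 (1)(2) over `ℤ/3^m`, refereed), on the Poitou–Tate families and Tate's local Euler–Poincaré
characteristic (named, unproved facts of the tree), and on the displayed pair counts.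

## What (Mazur–Rubin's liftability road, Mem. AMS 799 Thm. 4.4.3, with every non-published binder of
w2-c2 gen 3's `stubShape_of_s24Deep` / this seat's `stubShape_of_pinned` DISCHARGED or reduced to `∅`)

* ★ **`stubShape_pinned_of_sakamoto`** — for `1 ≤ k`, a tower row, `τ` deep to level `3^{2k+2}`, a finite
  `S ⊇ ∞ ∪ {3} ∪ {bad}`, generators `η`, and the PINNED canonical `τ`-datum `D_k` on `E[3^k·3]` (primes =
  Sakamoto's class of `τ` at `3^{k+1}`, cyclotomic transverse conditions, canonical comparison maps): every
  ℕ-generator `g` of `KS₁(E[3^{k+1}], 𝓕_can, 𝒫)` with `#H¹_{𝓕_can}(ℚ, E[3^{k+1}]) = 3^{k+1}·3^{n₀}` has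
  `g ∅ = 3^{n₀}•e + m′` (`e ∈ H¹_{𝓕_can}`, `m′ ∈ H¹_𝓚`) — item 19561's conclusion — GIVEN ONLY: [S24] (1)(2)
  pinned (PUB), the residual Poitou–Tate family at `3`, `hEP`, and the Poitou–Tate PAIR COUNTS AT THE EMPTY
  LEVEL `#H¹_{𝓕_can}(ℚ, E[3^{i+1}]) = 3^{i+1} · #H¹_{𝓕_can^*}(ℚ, E[3^{i+1}]^∨(1))` at the three levels
  `i ∈ {k, 2k, 2k+1}` (each for some full-level Poitou–Tate family; = n1011's
  `DeepLedger.natCard_selmerGroup_propagated_eq` given the local index datum `Λ` at `3`). Discharged inside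
  (against `stubShape_of_pinned`): the deep data `D̃`, `D_{2k}` (tower constructor), the generators `g̃`,
  `g_{2k}` with their orders and [S24] (2) order forms (w2-c2 gen 5's `exists_generator_kolyvaginSystems_deep_of_pinned`),
  the order form for `g` ([S24] (2) pinned instance), the GOOD CORE VERTEX `c` (w2-c4) at which all three
  generators have full order (`addOrderOf_apply_eq_rat_three_deep`), whence proportionality (L-c), rigidity
  (L-a) and liftability with NO pair count at transverse levels (sibling file `KimAtThreeStubPinnedLift`,
  `exists_proportional_lift_of_goodCoreVertex`), DUAL SATURATION between the levels `k, 2k, 2k+1` from orders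
  (`dual_exponent_eq_of_orders_of_le` / `…_lift`), and the three counts (iii) via
  `natCard_torsion_selmerGroup_eq_of_lt`; the deep case `n₀ ≥ k+1` is [S24] (2) clause 2 (`g ∅ = 0`).

References: [MazurRubin2004] Lemma 4.1.1, Thm. 4.1.13, Thm. 4.4.1, Thm. 4.4.3 (pp. 35–47); [Sakamoto2024]
Thm. 4.4 (1)(2) (p. 926), Lemma 5.2; [Rubin2011] Thm. 2.8.4, Cor. 2.8.9.
-/

set_option autoImplicit false
-- the Theorems namespace of a single-conjunct summit repeats the summit name by design (D-0017)
set_option linter.dupNamespace false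

noncomputable section

open scoped Classical NumberField ContRepresentation
open Function Field NumberField IsDedekindDomain WeierstrassCurve Literature.NumberTheory.EllipticCurves
  Literature.NumberTheory.GaloisRepresentations Literature.NumberTheory.GaloisRepresentations.DiscreteGaloisModule
  Literature.NumberTheory.GaloisCohomology Literature.NumberTheory.GaloisCohomology.KolyvaginDatum
  Summit.BirchSwinnertonDyer.Rank1Residual.GaloisImage Summit.BirchSwinnertonDyer.Rank1Residual.GaloisImage.Transport

namespace Summit.BirchSwinnertonDyer.BirchSwinnertonDyer.Theorems.KimAtThreeStubOfLiftable

open Summit.BirchSwinnertonDyer.BirchSwinnertonDyer.Theorems.KimAtThreeDeepLowerS24DeepTower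
open Summit.BirchSwinnertonDyer.BirchSwinnertonDyer.Theorems.KimAtThreeDeepLowerS24DeepOfPinned
open Summit.BirchSwinnertonDyer.BirchSwinnertonDyer.Theorems.KimAtThreeDeepLowerS24DeepOrderOfPinned
open Summit.BirchSwinnertonDyer.BirchSwinnertonDyer.Theorems.KimAtThreeShallowEqDeepGoodCoreVertex

/-! ### §3 The stub at `∅` for the pinned datum -/

/-- **Item 19561's conclusion for the PINNED datum from [S24] Thm. 4.4 (1)(2) AS PRINTED and three pair
counts at `∅`** (module docstring). For a tower row `E/ℚ`, `1 ≤ k`, `τ ∈ Γ_{ℚ(μ_{3^{2k+2}})}` with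
`E[3^{2k+1}·3]/(τ−1) ≃ ℤ/3^{2k+2}`, a residual Poitou–Tate family at `3`, Tate's local Euler–Poincaré
characteristic, a finite `S ⊇ ∞ ∪ {3} ∪ {bad}`, generators `η`, the PINNED canonical `τ`-datum `D_k` of
`E[3^k·3]` and an ℕ-generator `g` of `KS₁(E[3^k·3], 𝓕_can, 𝒫)` with `#H¹_{𝓕_can}(ℚ,E[3^k·3]) = 3^{k+1+n₀}`;
and, at the levels `i = k, 2k, 2k+1`, a full-level Poitou–Tate family `inv_i` with the pair count
`#H¹_{𝓕_can}(ℚ, E[3^i·3]) = 3^{i+1} · #H¹_{𝓕_can^*}(ℚ, E[3^i·3]^∨(1))`: THEN `g ∅ = 3^{n₀}•e + m′` with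
`e ∈ H¹_{𝓕_can}(ℚ, E[3^k·3])`, `m′ ∈ H¹_𝓚`. [cite: MazurRubin2004, Thm. 4.4.3 (pp. 46–47) and Lemma 4.1.1]
[cite: Sakamoto2024, Thm. 4.4 (1)(2) (p. 926)] -/
theorem stubShape_pinned_of_sakamoto
    (hS24 : Sakamoto2024.kolyvaginSystems_freeRankOne_zmod_three_pow)
    (hS24₂ : Sakamoto2024.kolyvaginSystems_idealOfBasis_eq_fittingIdeal_zmod_three_pow)
    (W : WeierstrassCurve ℚ) [W.IsElliptic] [Finite (geomTorsion W ((3 : ℕ) : ℤ))]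
    (htower : ∀ n : ℕ, W.HasSurjectiveModNGaloisRep (3 ^ n : ℕ)) {k : ℕ} (hk : 1 ≤ k) {n₀ : ℕ}
    [Finite (geomTorsion W (((3 : ℕ) : ℤ) ^ k * ((3 : ℕ) : ℤ)))]
    [Finite (geomTorsion W (((3 : ℕ) : ℤ) ^ (k + k) * ((3 : ℕ) : ℤ)))]
    [Finite (geomTorsion W (((3 : ℕ) : ℤ) ^ (k + k + 1) * ((3 : ℕ) : ℤ)))]
    -- `τ` at the deepest level `3^{2k+2}` and the residual Poitou–Tate family at `3`
    (τ : absoluteGaloisGroup ℚ) (hτμ : τ ∈ rootsOfUnityFixer ℚ (3 ^ (k + k + 1 + 1)))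
    (hτq : Nonempty (cokerSubOne (W.torsionGaloisModule (((3 : ℕ) : ℤ) ^ (k + k + 1) * ((3 : ℕ) : ℤ))) τ ≃+
      ZMod (3 ^ (k + k + 1 + 1))))
    (inv₃ : LocalInvariants ℚ 3) (hperf₃ : inv₃.IsPerfect) (hsum₃ : inv₃.SumLocalTermEqZero)
    (hcompl₃ : inv₃.SelmerComplement)
    (hEP : ∀ v : HeightOneSpectrum (𝓞 ℚ), localEulerPoincareCharacteristic (v.adicCompletion ℚ))
    {S : Finset (Place ℚ)} (hS : ∀ w : InfinitePlace ℚ, (Sum.inl w : Place ℚ) ∈ S)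
    (h3S : ∀ v : HeightOneSpectrum (𝓞 ℚ), ((3 : ℕ) : 𝓞 ℚ) ∈ v.asIdeal → (Sum.inr v : Place ℚ) ∈ S)
    (hbadS : ∀ v : HeightOneSpectrum (𝓞 ℚ), ¬ W.HasGoodReductionAt v → (Sum.inr v : Place ℚ) ∈ S)
    {η : (q : HeightOneSpectrum (𝓞 ℚ)) → (ZMod (Ideal.absNorm q.asIdeal))ˣ}
    (hη : ∀ q, Subgroup.zpowers (η q) = ⊤)
    -- the PINNED datum at level `k` and its ℕ-generator
    {Dk : KolyvaginDatum (W.torsionGaloisModule (((3 : ℕ) : ℤ) ^ k * ((3 : ℕ) : ℤ)))}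
    (hPk : Dk.primes = frobeniusClassPrimes (W.torsionGaloisModule (((3 : ℕ) : ℤ) ^ k * ((3 : ℕ) : ℤ)))
      {v | (Sum.inr v : Place ℚ) ∈ S} τ (3 ^ (k + 1)))
    (hTk : Dk.transverse = cyclotomicTransverse _) (hDk : Dk.HasCanonicalComparison (3 ^ (k + 1)) η)
    {g : Finset (HeightOneSpectrum (𝓞 ℚ)) →
      galoisCohomology (W.torsionGaloisModule (((3 : ℕ) : ℤ) ^ k * ((3 : ℕ) : ℤ))) 1}
    (hg : g ∈ Dk.kolyvaginSystems (propagatedSelmerStructure W 3 k))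
    (hgen : ∀ κ ∈ Dk.kolyvaginSystems (propagatedSelmerStructure W 3 k), ∃ a : ℕ, κ = a • g)
    (hcardk : Nat.card (propagatedSelmerStructure W 3 k).selmerGroup = 3 ^ (k + 1 + n₀))
    -- the Poitou–Tate pair counts at `∅` at the levels `k`, `2k`, `2k + 1`
    (invk : LocalInvariants ℚ (3 ^ (k + 1))) (hperfk : invk.IsPerfect) (hsumk : invk.SumLocalTermEqZero)
    (hcomplk : invk.SelmerComplement)
    (hPTk : Nat.card (propagatedSelmerStructure W 3 k).selmerGroup =
      3 ^ (k + 1) * Nat.card (invk.dualSelmerStructure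
        (W.torsionGaloisModule (((3 : ℕ) : ℤ) ^ k * ((3 : ℕ) : ℤ))) (propagatedSelmerStructure W 3 k)).selmerGroup)
    (invm : LocalInvariants ℚ (3 ^ (k + k + 1))) (hperfm : invm.IsPerfect) (hsumm : invm.SumLocalTermEqZero)
    (hcomplm : invm.SelmerComplement)
    (hPTm : Nat.card (propagatedSelmerStructure W 3 (k + k)).selmerGroup =
      3 ^ (k + k + 1) * Nat.card (invm.dualSelmerStructure
        (W.torsionGaloisModule (((3 : ℕ) : ℤ) ^ (k + k) * ((3 : ℕ) : ℤ)))
          (propagatedSelmerStructure W 3 (k + k))).selmerGroup)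
    (invt : LocalInvariants ℚ (3 ^ (k + k + 1 + 1))) (hperft : invt.IsPerfect)
    (hsumt : invt.SumLocalTermEqZero) (hcomplt : invt.SelmerComplement)
    (hPTt : Nat.card (propagatedSelmerStructure W 3 (k + k + 1)).selmerGroup =
      3 ^ (k + k + 1 + 1) * Nat.card (invt.dualSelmerStructure
        (W.torsionGaloisModule (((3 : ℕ) : ℤ) ^ (k + k + 1) * ((3 : ℕ) : ℤ)))
          (propagatedSelmerStructure W 3 (k + k + 1))).selmerGroup) :
    ∃ e ∈ (propagatedSelmerStructure W 3 k).selmerGroup,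
      ∃ m' ∈ (W.kummerSelmerStructure (((3 : ℕ) : ℤ) ^ k * ((3 : ℕ) : ℤ))).selmerGroup,
        g ∅ = 3 ^ n₀ • e + m' := by
  haveI : Fact (Nat.Prime 3) := ⟨Nat.prime_three⟩
  -- `k = j + 1`; the levels are `k = j+1`, `km = 2k = j+1+(j+1)`, `kt = 2k+1`
  obtain ⟨j, rfl⟩ : ∃ j, k = j + 1 := ⟨k - 1, by omega⟩
  have hkkt : (j + 1) ≤ (j + 1 + (j + 1) + 1) := by omega
  have hkmt : (j + 1 + (j + 1)) ≤ (j + 1 + (j + 1) + 1) := by omega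
  have hkt1 : 1 ≤ (j + 1 + (j + 1) + 1) := by omega
  have hkm1 : 1 ≤ (j + 1 + (j + 1)) := by omega
  haveI hfinall : ∀ i : ℕ, Finite (geomTorsion W (((3 : ℕ) : ℤ) ^ i * ((3 : ℕ) : ℤ))) := fun i =>
    finite_geomTorsion_pow_mul W 3 i
  haveI : NeZero (3 ^ ((j + 1) + 1)) := ⟨pow_ne_zero _ three_ne_zero⟩
  haveI : NeZero (3 ^ ((j + 1 + (j + 1)) + 1)) := ⟨pow_ne_zero _ three_ne_zero⟩
  haveI : NeZero (3 ^ ((j + 1 + (j + 1) + 1) + 1)) := ⟨pow_ne_zero _ three_ne_zero⟩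
  have hsurj : W.HasSurjectiveModNGaloisRep ((3 : ℕ) : ℤ) := by simpa using htower 1
  have hunro₃ : inv₃.UnramifiedOrthogonal :=
    UnramifiedCup.unramifiedOrthogonal_of_isPerfect inv₃ Nat.prime_three.isPrimePow hperf₃
  -- the `τ`-data at every level `≤ kt`, and on `E[3]`
  have hτ : ∀ i, i ≤ (j + 1 + (j + 1) + 1) →
      Nonempty (cokerSubOne (W.torsionGaloisModule (((3 : ℕ) : ℤ) ^ i * ((3 : ℕ) : ℤ))) τ ≃+ ZMod (3 ^ (i + 1))) := by
    intro i hi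
    have hl' : ((3 : ℕ) : ℤ) ^ ((j + 1 + (j + 1) + 1) + 1) = ((3 : ℕ) : ℤ) ^ (j + 1 + (j + 1) + 1) * ((3 : ℕ) : ℤ) := pow_succ _ _
    have hl : ((3 : ℕ) : ℤ) ^ (i + 1) = ((3 : ℕ) : ℤ) ^ i * ((3 : ℕ) : ℤ) := pow_succ _ _
    have h1 : Nonempty (cokerSubOne (W.torsionGaloisModule (((3 : ℕ) : ℤ) ^ ((j + 1 + (j + 1) + 1) + 1))) τ ≃+
        ZMod (3 ^ ((j + 1 + (j + 1) + 1) + 1))) := by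
      rw [hl']; exact hτq
    have h := nonempty_cokerSubOne_equiv_zmod_pow_of_le W Nat.prime_three (Nat.succ_le_succ hi) τ h1
    rw [hl] at h
    exact h
  have hτq₁ : Nonempty (cokerSubOne (W.torsionGaloisModule ((3 : ℕ) : ℤ)) τ ≃+ ZMod 3) := by
    have h := hτ 0 (Nat.zero_le _)
    have hl : ((3 : ℕ) : ℤ) ^ 0 * ((3 : ℕ) : ℤ) = ((3 : ℕ) : ℤ) := by rw [pow_zero, one_mul]
    rw [hl] at h
    simpa using h
  have hτμ_of : ∀ i, i ≤ (j + 1 + (j + 1) + 1) → τ ∈ rootsOfUnityFixer ℚ (3 ^ (i + 1)) := fun i hi =>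
    rootsOfUnityFixer_le_of_dvd ℚ (pow_dvd_pow 3 (Nat.succ_le_succ hi)) hτμ
  -- the admissible set `S`: the inputs of the pinned instances at level `k`
  let T : Finset (HeightOneSpectrum (𝓞 ℚ)) := S.preimage Sum.inr Sum.inr_injective.injOn
  have h3T : ∀ v : HeightOneSpectrum (𝓞 ℚ), ((3 : ℕ) : 𝓞 ℚ) ∈ v.asIdeal → v ∈ T :=
    fun v hv => Finset.mem_preimage.mpr (h3S v hv)
  have hbadT : ∀ v : HeightOneSpectrum (𝓞 ℚ), ¬ W.HasGoodReductionAt v → v ∈ T :=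
    fun v hv => Finset.mem_preimage.mpr (hbadS v hv)
  have hCR := hasCoreRank_one_propagatedSelmerStructureOne_of_isPerfect_of_localEuler W inv₃ hperf₃ hsum₃
    hcompl₃ hEP T h3T hbadT
  have hS' : ∀ i, ∀ v : HeightOneSpectrum (𝓞 ℚ), (Sum.inr v : Place ℚ) ∉ S →
      ((3 : ℕ) : 𝓞 ℚ) ∉ v.asIdeal ∧ GaloisRep.IsUnramifiedAt v
        (W.torsionGaloisModule (((3 : ℕ) : ℤ) ^ i * ((3 : ℕ) : ℤ))) := fun i v hv =>
    not_mem_and_isUnramifiedAt_of_not_mem W 3 i S h3S hbadS hv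
  have hunr : ∀ i, (propagatedSelmerStructure W 3 i).IsUnramifiedOutside S := fun i =>
    propagatedSelmerStructure_isUnramifiedOutside W 3 i S hS h3S hbadS
  haveI hfinSel : ∀ i, Finite (propagatedSelmerStructure W 3 i).selmerGroup := fun i =>
    SelmerFinite.finite_selmerGroup_of_isUnramifiedOutside _ (fun v hv => (hS' i v hv).2) (hunr i)
  -- `#N_k(∅) = 3^{n₀}`
  have hNk : Nat.card (invk.dualSelmerStructure
      (W.torsionGaloisModule (((3 : ℕ) : ℤ) ^ (j + 1) * ((3 : ℕ) : ℤ))) (propagatedSelmerStructure W 3 (j + 1))).selmerGroup =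
        3 ^ n₀ := by
    apply eq_pow_of_mul_eq_mul_pow (i := (j + 1) + 1)
    rw [← hPTk, hcardk, pow_add]
  -- [S24] Thm. 4.4 (1)(2) PINNED for `D_k` (n1011 instances; (H.3), cartesian, core rank, coisotropy discharged)
  have hpin := kolyvaginSystems_freeRankOne_propagatedSelmerStructure_of_towerSurj W hS24 (j + 1) htower τ
    (hτμ_of (j + 1) hkkt) (hτ (j + 1) hkkt) inv₃ hperf₃ hsum₃ hunro₃ hcompl₃ S hS (hS' (j + 1)) (hunr (j + 1)) (fun v _ => hEP v)
    hCR Dk η hPk hTk hDk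
  have hzg : AddSubgroup.zmultiples (⟨g, hg⟩ : Dk.kolyvaginSystems (propagatedSelmerStructure W 3 (j + 1))) = ⊤ :=
    zmultiples_mk_eq_top_of_forall_eq_nsmul hg hgen
  have hR22k := kolyvaginSystems_idealOfBasis_propagatedSelmerStructure_of_towerSurj W hS24₂ (j + 1) htower τ
    (hτμ_of (j + 1) hkkt) (hτ (j + 1) hkkt) inv₃ hperf₃ hsum₃ hunro₃ hcompl₃ S hS (hS' (j + 1)) (hunr (j + 1)) (fun v _ => hEP v)
    hCR Dk η hPk hTk hDk invk hperfk hsumk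
    (UnramifiedCup.unramifiedOrthogonal_of_isPerfect invk
      (Nat.prime_three.isPrimePow.pow (Nat.succ_ne_zero (j + 1))) hperfk)
    hcomplk ⟨g, hg⟩ hzg ∅ (KolyvaginDatum.isLevel_empty Dk)
  rw [atLevel_empty, hNk] at hR22k
  -- THE DEEP CASE `n₀ ≥ k + 1`: `g ∅ = 0` ([S24] (2) clause 2)
  rcases Nat.lt_or_ge n₀ ((j + 1) + 1) with hn₀ | hn₀
  swap
  · have h0 : g ∅ = 0 := hR22k.2 (pow_dvd_pow 3 hn₀)
    exact ⟨0, zero_mem _, 0, zero_mem _, by rw [h0, smul_zero, add_zero]⟩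
  -- THE SHALLOW CASE `n₀ ≤ k`: the order (iv) of `g ∅`
  have hn₀k : n₀ ≤ (j + 1) := Nat.lt_succ_iff.mp hn₀
  have hord : addOrderOf (g ∅) * 3 ^ n₀ = 3 ^ ((j + 1) + 1) := hR22k.1 (pow_dvd_pow 3 (by omega))
  have hordj : addOrderOf (g ∅) = 3 ^ ((j + 1) + 1 - n₀) := by
    have h := hord
    have hsplit : 3 ^ ((j + 1) + 1) = 3 ^ ((j + 1) + 1 - n₀) * 3 ^ n₀ := by
      rw [← pow_add, Nat.sub_add_cancel (by omega)]
    rw [hsplit] at h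
    exact Nat.eq_of_mul_eq_mul_right (pow_pos (by norm_num) _) h
  -- the `E[3]`-datum on the deep class (through `E[3^{kt}·3]`) and the GOOD CORE VERTEX `c`
  obtain ⟨D₁, hP₁, hT₁, -⟩ := exists_deepDatum_torsion_three W (j + 1 + (j + 1) + 1) {v | (Sum.inr v : Place ℚ) ∈ S}
    hτμ hτq₁ η hη
  haveI : Finite (W.kummerSelmerStructure ((3 : ℕ) : ℤ)).selmerGroup := by
    rw [← selmerGroup_eq_selmerGroup_kummerSelmerStructure]
    exact W.finite_selmerGroup_holds (by norm_num)
  obtain ⟨c, -, hc₁, hdual, -, -⟩ := exists_superset_kummerSelmerGroup_eq_bot_rat_three_deep W hsurj (j + 1 + (j + 1) + 1) τ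
    hτμ hτq₁ inv₃ hperf₃ hsum₃ hcompl₃ S hS h3S hbadS D₁ hP₁ hT₁ (KolyvaginDatum.isLevel_empty D₁)
  have hbot : (inv₃.dualSelmerStructure (W.torsionGaloisModule ((3 : ℕ) : ℤ))
      ((W.kummerSelmerStructure ((3 : ℕ) : ℤ)).transverseAt
        (cyclotomicTransverse (W.torsionGaloisModule ((3 : ℕ) : ℤ))) c)).selmerGroup = ⊥ := by
    have h := hdual
    change (inv₃.dualSelmerStructure _ ((W.kummerSelmerStructure ((3 : ℕ) : ℤ)).transverseAt
      D₁.transverse c)).selmerGroup = ⊥ at h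
    rwa [hT₁] at h
  -- the deep class is inside every shallower class
  have hdeep_sub : ∀ i, i ≤ (j + 1 + (j + 1) + 1) →
      frobeniusClassPrimes (W.torsionGaloisModule (((3 : ℕ) : ℤ) ^ (j + 1 + (j + 1) + 1) * ((3 : ℕ) : ℤ)))
          {v | (Sum.inr v : Place ℚ) ∈ S} τ (3 ^ ((j + 1 + (j + 1) + 1) + 1)) ⊆
        frobeniusClassPrimes (W.torsionGaloisModule (((3 : ℕ) : ℤ) ^ i * ((3 : ℕ) : ℤ)))
          {v | (Sum.inr v : Place ℚ) ∈ S} τ (3 ^ (i + 1)) := fun i hi =>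
    S24Deep.frobeniusClassPrimes_torsion_pow_mul_mono W ((3 : ℕ) : ℤ) hi _ τ
      (pow_dvd_pow 3 (Nat.succ_le_succ hi))
  have hck : Dk.IsLevel c := fun q hq => by
    rw [hPk]
    exact hdeep_sub (j + 1) hkkt (hP₁ ▸ hc₁ hq)
  -- the deep data: `D̃` at level `kt` on its own class, and `D_{2k}` from the tower below it
  obtain ⟨Dt, hPt, hTt, hDt⟩ := FSComp.exists_kolyvaginDatum_hasCanonicalComparison_frobeniusClassPrimes
    (W.torsionGaloisModule (((3 : ℕ) : ℤ) ^ (j + 1 + (j + 1) + 1) * ((3 : ℕ) : ℤ))) (3 ^ ((j + 1 + (j + 1) + 1) + 1))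
    {v | (Sum.inr v : Place ℚ) ∈ S} hτμ hτq
    (cyclotomicTransverse (W.torsionGaloisModule (((3 : ℕ) : ℤ) ^ (j + 1 + (j + 1) + 1) * ((3 : ℕ) : ℤ)))) η (fun q _ => hη q)
  obtain ⟨Dd, -, hDd⟩ := exists_deepTower_torsion_pow_mul W (le_refl (j + 1 + (j + 1) + 1)) {v | (Sum.inr v : Place ℚ) ∈ S}
    hτμ hτ Dt η hη hPt hTt hDt
  obtain ⟨Dm, hPm, hTm, hDm⟩ :
      ∃ Dm : KolyvaginDatum (W.torsionGaloisModule (((3 : ℕ) : ℤ) ^ (j + 1 + (j + 1)) * ((3 : ℕ) : ℤ))),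
        Dm.primes = frobeniusClassPrimes (W.torsionGaloisModule (((3 : ℕ) : ℤ) ^ (j + 1 + (j + 1) + 1) * ((3 : ℕ) : ℤ)))
            {v | (Sum.inr v : Place ℚ) ∈ S} τ (3 ^ ((j + 1 + (j + 1) + 1) + 1)) ∧
          Dm.transverse = cyclotomicTransverse _ ∧ Dm.HasCanonicalComparison (3 ^ ((j + 1 + (j + 1)) + 1)) η :=
    ⟨Dd (j + 1 + (j + 1)), (hDd (j + 1 + (j + 1)) hkmt).1, (hDd (j + 1 + (j + 1)) hkmt).2.1, (hDd (j + 1 + (j + 1)) hkmt).2.2⟩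
  have hct : Dt.IsLevel c := fun q hq => by
    rw [hPt]
    exact hP₁ ▸ hc₁ hq
  have hcm : Dm.IsLevel c := fun q hq => by
    rw [hPm]
    exact hP₁ ▸ hc₁ hq
  have hsubt : Dt.primes ⊆ Dk.primes := by
    rw [hPt, hPk]
    exact hdeep_sub (j + 1) hkkt
  have hsubmt : Dt.primes ⊆ Dm.primes := by rw [hPt, hPm]
  -- the reductions `red : E[3^{kt}·3] → E[3^k·3]` and `red′ : E[3^{kt}·3] → E[3^{km}·3]`
  obtain ⟨red, hred⟩ := exists_torsionReduction_three W (j + 1) (j + 1 + (j + 1) + 1)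
  obtain ⟨red', hred'⟩ := exists_torsionReduction_three W (j + 1 + (j + 1)) (j + 1 + (j + 1) + 1)
  -- the generators of the deep data with [S24] (2) in order form (ports replaced by the pinned facts)
  obtain ⟨κt, -, -, hgent, hR22t⟩ := exists_generator_kolyvaginSystems_deep_of_pinned W hS24 hS24₂ hkt1
    (le_refl (j + 1 + (j + 1) + 1)) htower τ hτμ hτq inv₃ hperf₃ hsum₃ hcompl₃ hEP S hS h3S hbadS Dt η hPt hTt hDt hct hbot
  obtain ⟨κm, -, -, hgenm, hR22m⟩ := exists_generator_kolyvaginSystems_deep_of_pinned W hS24 hS24₂ hkm1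
    hkmt htower τ hτμ hτq inv₃ hperf₃ hsum₃ hcompl₃ hEP S hS h3S hbadS Dm η hPm hTm hDm hcm hbot
  -- [S24] (1) on the deep class for `D̃` and `D_{2k}` (sibling file `KimAtThreeStubOfPinned`)
  obtain ⟨hfreet, hbijt⟩ := kolyvaginSystems_freeRankOne_deep_of_pinned_of_towerSurj hS24 W hkt1 (le_refl (j + 1 + (j + 1) + 1))
    htower τ hτμ hτq inv₃ hperf₃ hsum₃ hcompl₃ hEP S hS h3S hbadS Dt η hPt hTt hDt
  obtain ⟨hfreem, hbijm⟩ := kolyvaginSystems_freeRankOne_deep_of_pinned_of_towerSurj hS24 W hkm1 hkmt htower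
    τ hτμ hτq inv₃ hperf₃ hsum₃ hcompl₃ hEP S hS h3S hbadS Dm η hPm hTm hDm
  -- FULL ORDER of the three generators at the good core vertex `c`, and bijectivity of evaluation there
  have hgc : addOrderOf (g c) = 3 ^ ((j + 1) + 1) :=
    addOrderOf_apply_eq_rat_three_deep W j (hτμ_of (j + 1) hkkt) (hτ (j + 1) hkkt) (hτ j (by omega)) hτq₁ inv₃ D₁ Dk
      (le_of_eq hPk) hT₁ hTk hpin.1 hpin.2 g hg hgen hck hdual
  have hgtc : addOrderOf (κt.1 c) = 3 ^ ((j + 1 + (j + 1) + 1) + 1) :=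
    addOrderOf_apply_eq_rat_three_deep W (j + 1 + (j + 1)) hτμ hτq (hτ (j + 1 + (j + 1)) hkmt) hτq₁ inv₃ D₁ Dt
      (le_of_eq hPt) hT₁ hTt hfreet hbijt κt.1 κt.2 hgent hct hdual
  have hgmc : addOrderOf (κm.1 c) = 3 ^ ((j + 1 + (j + 1)) + 1) :=
    addOrderOf_apply_eq_rat_three_deep W (j + 1 + j) (hτμ_of (j + 1 + (j + 1)) hkmt) (hτ (j + 1 + (j + 1)) hkmt)
      (hτ (j + 1 + j) (by omega)) hτq₁ inv₃ D₁ Dm (hPm ▸ hdeep_sub (j + 1 + (j + 1)) hkmt) hT₁ hTm hfreem hbijm κm.1 κm.2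
      hgenm hcm hdual
  have hbijk := hpin.2 c hck (lambdaStar_induced_atLevel_eq_zero_rat_three_deep W j (hτμ_of (j + 1) hkkt)
    (hτ (j + 1) hkkt) (hτ j (by omega)) hτq₁ inv₃ D₁ Dk (le_of_eq hPk) hT₁ hTk hck hdual)
  have hbijmc := hbijm c hcm (lambdaStar_induced_atLevel_eq_zero_rat_three_deep W (j + 1 + j) (hτμ_of (j + 1 + (j + 1)) hkmt)
    (hτ (j + 1 + (j + 1)) hkmt) (hτ (j + 1 + j) (by omega)) hτq₁ inv₃ D₁ Dm (hPm ▸ hdeep_sub (j + 1 + (j + 1)) hkmt) hT₁ hTm hcm hdual)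
  -- (L-a) + (L-c) ⟹ proportionality at `∅` and liftability, for the pairs `(k, kt)` and `(km, kt)` (sibling file)
  obtain ⟨w, hwco, hcmp0, hx⟩ := exists_proportional_lift_of_goodCoreVertex hS24 W htower hk hkkt red hred τ hτμ
    hτq inv₃ hperf₃ hsum₃ hcompl₃ hEP hS h3S hbadS hTk hDk hPt hsubt hTt hDt hg hgen κt.2 hct hbijk hgc hgtc
  obtain ⟨w', hwco', hcmp0', -⟩ := exists_proportional_lift_of_goodCoreVertex hS24 W htower hkm1 hkmt red' hred'
    τ hτμ hτq inv₃ hperf₃ hsum₃ hcompl₃ hEP hS h3S hbadS hTm hDm hPt hsubmt hTt hDt κm.2 hgenm κt.2 hct hbijmc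
    hgmc hgtc
  -- the dual counts at `∅` at the levels `kt`, `km` are powers of `3`
  have hTD : ∀ (i : ℕ) (F : SelmerStructure (W.torsionGaloisModule (((3 : ℕ) : ℤ) ^ i * ((3 : ℕ) : ℤ))))
      (inv' : LocalInvariants ℚ (3 ^ (i + 1))),
      Nat.card (propagatedSelmerStructure W 3 i).selmerGroup =
        3 ^ (i + 1) * Nat.card (inv'.dualSelmerStructure _ F).selmerGroup →
      ∃ n, Nat.card (inv'.dualSelmerStructure _ F).selmerGroup = 3 ^ n := by
    intro i F inv' hPT
    have hne : Nat.card (inv'.dualSelmerStructure _ F).selmerGroup ≠ 0 := fun h => by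
      rw [h, mul_zero] at hPT
      exact (Nat.card_pos (α := (propagatedSelmerStructure W 3 i).selmerGroup)).ne' hPT
    haveI : Finite (inv'.dualSelmerStructure _ F).selmerGroup := Nat.finite_of_card_ne_zero hne
    exact exists_natCard_eq_pow_of_nsmul_eq_zero (p := 3) (K := i + 1) fun n => Subtype.ext (by
      rw [AddSubmonoidClass.coe_nsmul, ZeroMemClass.coe_zero]
      exact galoisCohomology.nsmul_eq_zero_of_forall _
        (fun f => DiscreteGaloisModule.TateDual.nsmul_eq_zero f) n.1)
  obtain ⟨nt, hNt⟩ := hTD (j + 1 + (j + 1) + 1) _ invt hPTt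
  obtain ⟨nm, hNm⟩ := hTD (j + 1 + (j + 1)) _ invm hPTm
  -- [S24] (2) at `∅` for `g̃` and `g_{2k}`, in the two-clause order form
  have hR22t0 := hR22t invt hperft hsumt hcomplt ∅ (KolyvaginDatum.isLevel_empty Dt)
  have hR22m0 := hR22m invm hperfm hsumm hcomplm ∅ (KolyvaginDatum.isLevel_empty Dm)
  rw [atLevel_empty, hNt] at hR22t0
  rw [atLevel_empty, hNm] at hR22m0
  have h13 : (1 : ℕ) < 3 := by norm_num
  -- DUAL SATURATION `nt = n₀` (levels `k ↔ kt`), the order of `g̃ ∅`, then `nm = n₀` (levels `km ↔ kt`)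
  have hnt : nt = n₀ :=
    dual_exponent_eq_of_orders_of_le (galoisCohomology.map red 1) (j := (j + 1)) (kt := (j + 1 + (j + 1) + 1))
      (g := (j + 1) + 1) (by omega) hn₀k hwco
      (fun a => by
        rw [show a + ((j + 1) + 1) = a + ((j + 1 + (j + 1) + 1) - (j + 1)) by omega]
        exact pow_nsmul_map_red_eq_zero_iff W hsurj hkkt red hred (κt.1 ∅) a)
      hcmp0 (pow_succ_nsmul_galoisCohomology W (j + 1) _) hordj
      (fun h => hR22t0.1 ((Nat.pow_dvd_pow_iff_le_right h13).mpr h))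
      (fun h => hR22t0.2 ((Nat.pow_dvd_pow_iff_le_right h13).mpr h))
  have hordt : addOrderOf (κt.1 ∅) = 3 ^ ((j + 1 + (j + 1) + 1) + 1 - n₀) := by
    have h := hR22t0.1 ((Nat.pow_dvd_pow_iff_le_right h13).mpr (by omega))
    have hsplit : 3 ^ ((j + 1 + (j + 1) + 1) + 1) = 3 ^ ((j + 1 + (j + 1) + 1) + 1 - n₀) * 3 ^ nt := by
      rw [hnt, ← pow_add, Nat.sub_add_cancel (by omega)]
    rw [hsplit] at h
    exact Nat.eq_of_mul_eq_mul_right (pow_pos (by norm_num) _) h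
  have hnm : nm = n₀ :=
    dual_exponent_eq_of_orders_lift (galoisCohomology.map red' 1) (m := (j + 1 + (j + 1))) (kt := (j + 1 + (j + 1) + 1)) (g := 1) rfl
      (by omega) hwco'
      (fun a => by
        rw [show a + 1 = a + ((j + 1 + (j + 1) + 1) - (j + 1 + (j + 1))) by omega]
        exact pow_nsmul_map_red_eq_zero_iff W hsurj hkmt red' hred' (κt.1 ∅) a)
      hcmp0' (pow_succ_nsmul_galoisCohomology W (j + 1 + (j + 1)) _) hordt
      (fun h => hR22m0.1 ((Nat.pow_dvd_pow_iff_le_right h13).mpr h))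
      (fun h => hR22m0.2 ((Nat.pow_dvd_pow_iff_le_right h13).mpr h))
  -- (iii) the three counts at the lift level
  have hcard : Nat.card (propagatedSelmerStructure W 3 (j + 1 + (j + 1) + 1)).selmerGroup = 3 ^ ((j + 1 + (j + 1) + 1) + 1 + n₀) := by
    rw [hPTt, hNt, hnt, ← pow_add]
  have hcardj : Nat.card {y : (propagatedSelmerStructure W 3 (j + 1 + (j + 1) + 1)).selmerGroup // 3 ^ ((j + 1 + (j + 1) + 1) - (j + 1)) • y = 0} =
      3 ^ ((j + 1 + (j + 1) + 1) - (j + 1) + n₀) := by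
    rw [show (j + 1 + (j + 1) + 1) - (j + 1) = (j + 1) + 1 by omega, natCard_torsion_selmerGroup_eq_of_lt W hsurj (by omega : (j + 1) < (j + 1 + (j + 1) + 1)),
      hcardk]
  have hcardtop : Nat.card {y : (propagatedSelmerStructure W 3 (j + 1 + (j + 1) + 1)).selmerGroup // 3 ^ (j + 1 + (j + 1) + 1) • y = 0} =
      3 ^ ((j + 1 + (j + 1) + 1) + n₀) := by
    rw [natCard_torsion_selmerGroup_eq_of_lt W hsurj (by omega : (j + 1 + (j + 1)) < (j + 1 + (j + 1) + 1)), hPTm, hNm, hnm, ← pow_add]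
  -- the liftability algebra (landed)
  exact stubShape_of_liftable_three_of_surj W hsurj (j + 1) (j + 1 + (j + 1) + 1) hkkt red hred hcard hcardj hcardtop hx hord

end Summit.BirchSwinnertonDyer.BirchSwinnertonDyer.Theorems.KimAtThreeStubOfLiftable

end
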